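import Summits.QuantumFields.BalabanUV.T4Continuum.Support.CTCovariantScalarGreen

/-!
# T⁴ programme, spine node NE2 (U1a), sub-row Δ3 «NE2-WALK» (T4-DAG `T4-U1a.S-NE2-D3-WALK°`) — THE GAUGE SANDWICH `D_R·G′Q′ᴴNQ′G′·D_Rᴴ` OF ONE
# FAMILY UNDER COMBES–THOMAS CONJUGATION, MODULO THE UNIT DATUM (coercivity of `K = Q′G′G′Q′ᴴ`) — file E2a of «Δ3-CT-HBD-B4»

NE2 formalisation swarm `b2b-balaban-t4-ne2-formalise-*`, leaf prover 06 (gen 3), supplier item «Δ3-CT-HBD-B4» file E2a (file E1 =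
`Support/CTCovariantScalarGreen`).  One level `n`, transporters `R` and site transports `T` as DATA, the transported scalar averaging
`Q′ = B·siteMul T` (`GaugeTermScalarData.QuT` at `n = n_k`), `S_U = scalarOp n M a′ R T`, `G′ = S_U⁻¹`, `K = Q′G′G′Q′ᴴ` on the unit index
`Tor M × o` with the COARSE weight `σ(y, c) = ρ₀(n·y + 0)` (`CTConjugationTorus.coarseW`):
 * §1 **`opNorm_conjMat_Qu_sub_le`** (`‖c(Q′) − Q′‖ ≤ (e^{|κ|} − 1)(1 + τ)`: substrate's `opNorm_conjMat_Qiso_sub_le`, `Bs = Qiso ⊗ 1`, site factors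
   commute), `opNorm_conjMat_Qu_le`, `opNorm_conjMat_QuH_le` (`≤ e^{|κ|}(1 + τ)`);
 * §2 **`opNorm_conjMat_Z_le`** (`Z = Q′G′D_Rᴴ`: `‖c(Z)‖ ≤ e^{|κ|}(1+τ)·K₂`), **`opNorm_conjMat_ZH_le`** (`‖c(Zᴴ)‖ ≤ (√(1/γw + J/γw²) + cR/γw)·e^{|κ|}(1+τ)`);
 * §3 **`opNorm_conjMat_sandwich_le`**: with a DISPLAYED bound `hN : ‖conjMat κ σ σ N‖ ≤ ν` on the conjugated unit-layer factor,
   `‖c(D_R·projP G′ Q′·D_Rᴴ)‖ ≤ ‖c(Zᴴ)‖·ν·‖c(Z)‖` (`GaugeTermSandwichBound.sand_projP_eq`).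
The bound `hN` itself (from a coercivity of `K` — the unit datum — and the smallness of `‖c(K) − K‖`) is file E2b `CTGaugeUnitFactorHbd`.

HONEST FRAMING (T4-DAG p. 1).  Bookkeeping over landed modules ([folklore]); statements OURS; MODEL level (no B0); `hN` DISPLAYED; Δ3 NOT closed; NE2
(U1a) NOT PROVED; spine PROVED 0/9 unchanged; NOT infinite volume, NOT a mass gap, NOT the Clay problem, NOT summit progress.  HONEST DEPENDENCY:
continuum YM on T⁴ ⇐ BetaPertH ∧ nine spine estimates (0/9 proved); BetaPertH ⇐ (D1) ∧ (D4) ∧ CAP+tail; G-an2-4 gates asym, D1 and NE2/3/4.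
ABSOLUTE RULE kept; no `sorry`.
-/

noncomputable section

open scoped BigOperators ComplexConjugate Matrix Matrix.Norms.L2Operator Kronecker ComplexOrder

namespace Summit.QuantumFields.BalabanUV.T4Continuum.CTGaugeSandwichHbd

open Literature.MathematicalPhysics.QuantumFieldTheory.Balaban1983to89.B5Prop11Plancherel (Tor fine unitVec)
open Literature.MathematicalPhysics.QuantumFieldTheory.Balaban1983to89.B5Blocks16 (blockOf)
open Summit.QuantumFields.BalabanUV.T4Continuum
open Summit.QuantumFields.BalabanUV.T4Continuum.BlockMultiplication (siteMul siteMul_apply opNorm_siteMul_le siteMul_conjTranspose)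
open Summit.QuantumFields.BalabanUV.T4Continuum.KroneckerLift (opNorm_kron_le_of_le sub_kronecker)
open Summit.QuantumFields.BalabanUV.T4Continuum.GaugeTermDecomposition (covGrad sand)
open Summit.QuantumFields.BalabanUV.T4Continuum.GaugeTermSandwichBound (projP Zop Nop sand_projP_eq)
open Summit.QuantumFields.BalabanUV.T4Continuum.ScalarAveragedCompression (Qiso opNorm_Qiso_le)
open Summit.QuantumFields.BalabanUV.T4Continuum.ScalarCovariantLaplacian (scalarOp connS Bs opNorm_Bs_le Bs_conjTranspose_mul_Bs)
open Summit.QuantumFields.BalabanUV.T4Continuum.ScalarBlockPoincare (PiS)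
open Summit.QuantumFields.BalabanUV.T4Continuum.ScalarCovariantCoercive (gammaU siteW Jcov Jcov_nonneg scalarOp_isHermitian
  opNorm_siteMul_le_one_add isUnit_scalarOp opNorm_scalarOp_inv_le)
open Summit.QuantumFields.BalabanUV.T4Continuum.GaugeTermResolventBounds (opNorm_mul_inv_le_sqrt)
open Summit.QuantumFields.BalabanUV.T4Continuum.GaugeTermScalarData (Bs_eq_Qiso_kron)
open Summit.QuantumFields.BalabanUV.T4Continuum.CTWeightedCoercivity
open Summit.QuantumFields.BalabanUV.T4Continuum.CTConjugationPieces (opNorm_conjMat_le_add conjMat_of_sameWeight conjMat_conjTranspose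
  opNorm_conjMat_conjTranspose_sub_eq conjMat_inv opNorm_conjMat_inv_le)
open Summit.QuantumFields.BalabanUV.T4Continuum.CoerciveInverseTower (Coercive)
open Summit.QuantumFields.BalabanUV.T4Continuum.CTConjugationTorus (coarseW opNorm_conjMat_Qiso_sub_le opNorm_conjMat_PiS_sub_le)
open Summit.QuantumFields.BalabanUV.T4Continuum.CTWeightedEnergy (K1 K2 K1_nonneg K2_nonneg)
open Summit.QuantumFields.BalabanUV.T4Continuum.CTCovariantLaplacianDecay (conjMat_kron)
open Summit.QuantumFields.BalabanUV.T4Continuum.CTCovariantScalarGreen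

variable {d : ℕ} (n : ℕ) [NeZero n] (M : Fin d → ℕ) [hM : ∀ μ, NeZero (M μ)]
variable {o : Type*} [Fintype o] [DecidableEq o]

/-- the coarse-colour weight on the unit index `Tor M × o`: the site weight at the corner of the block. [folklore] -/
abbrev coarseCW (ρ₀ : Tor (fine n M) → ℝ) : Tor M × o → ℝ := fun q => coarseW n M ρ₀ q.1

/-! ## §1 The transported scalar averaging `Q′ = B·siteMul T` under conjugation -/

section Averaging

variable {ρ₀ : Tor (fine n M) → ℝ} {κ : ℝ}

omit [NeZero n] hM [Fintype o] [DecidableEq o] in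
/-- site factors on `Tor (fine n M) × o` commute with the conjugation. [folklore] -/
theorem conjMat_siteMul_site (w : Tor (fine n M) → Matrix o o ℂ) :
    conjMat κ (siteW n M ρ₀) (siteW n M ρ₀) (siteMul w) = siteMul w := by
  refine conjMat_of_sameWeight κ _ _ _ fun p q h => ?_
  rw [siteMul_apply] at h
  by_cases hpq : p.1 = q.1
  · show ρ₀ p.1 = ρ₀ q.1; rw [hpq]
  · exact absurd (if_neg hpq) (fun h0 => h (h0 ▸ rfl))

/-- **`‖c(B) − B‖ ≤ e^{|κ|Λ} − 1`** for the normalised free scalar averaging `B = Q̃′ ⊗ 1` (substrate's `opNorm_conjMat_Qiso_sub_le`). [folklore] -/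
theorem opNorm_conjMat_Bs_sub_le (κ : ℝ) {Λ : ℝ} (hΛ : 0 ≤ Λ) (hosc : ∀ x x', blockOf n M x = blockOf n M x' → |ρ₀ x - ρ₀ x'| ≤ Λ) :
    ‖conjMat κ (coarseCW n M (o := o) ρ₀) (siteW n M ρ₀) (Bs o n M) - Bs o n M‖ ≤ Real.exp (|κ| * Λ) - 1 := by
  have e : conjMat κ (coarseCW n M (o := o) ρ₀) (siteW n M ρ₀) (Bs o n M) = conjMat κ (coarseW n M ρ₀) ρ₀ (Qiso n M) ⊗ₖ (1 : Matrix o o ℂ) := by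
    rw [Bs_eq_Qiso_kron]; exact conjMat_kron κ (coarseW n M ρ₀) ρ₀ (Qiso n M) (1 : Matrix o o ℂ)
  rw [e, Bs_eq_Qiso_kron, ← sub_kronecker]
  exact opNorm_kron_le_of_le o (opNorm_conjMat_Qiso_sub_le n M κ hΛ hosc)

/-- **`‖c(Q′) − Q′‖ ≤ (e^{|κ|Λ} − 1)(1 + τ)`** for `Q′ = B·siteMul T`, `‖T(x) − 1‖ ≤ τ`. [folklore] -/
theorem opNorm_conjMat_Qu_sub_le (κ : ℝ) {Λ τ : ℝ} (hΛ : 0 ≤ Λ) (hτ : 0 ≤ τ)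
    (hosc : ∀ x x', blockOf n M x = blockOf n M x' → |ρ₀ x - ρ₀ x'| ≤ Λ) {T : Tor (fine n M) → Matrix o o ℂ} (hT : ∀ x, ‖T x - 1‖ ≤ τ) :
    ‖conjMat κ (coarseCW n M (o := o) ρ₀) (siteW n M ρ₀) (Bs o n M * siteMul T) - Bs o n M * siteMul T‖ ≤ (Real.exp (|κ| * Λ) - 1) * (1 + τ) := by
  rw [conjMat_mul κ _ (siteW n M ρ₀) _, conjMat_siteMul_site, ← Matrix.sub_mul]
  exact (Matrix.l2_opNorm_mul _ _).trans (mul_le_mul (opNorm_conjMat_Bs_sub_le n M κ hΛ hosc) (opNorm_siteMul_le_one_add n M hτ hT)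
    (norm_nonneg _) (sub_nonneg.mpr (Real.one_le_exp (by positivity))))

/-- hence `‖c(Q′)‖ ≤ e^{|κ|Λ}(1 + τ)`. [folklore] -/
theorem opNorm_conjMat_Qu_le (κ : ℝ) {Λ τ : ℝ} (hΛ : 0 ≤ Λ) (hτ : 0 ≤ τ)
    (hosc : ∀ x x', blockOf n M x = blockOf n M x' → |ρ₀ x - ρ₀ x'| ≤ Λ) {T : Tor (fine n M) → Matrix o o ℂ} (hT : ∀ x, ‖T x - 1‖ ≤ τ) :
    ‖conjMat κ (coarseCW n M (o := o) ρ₀) (siteW n M ρ₀) (Bs o n M * siteMul T)‖ ≤ Real.exp (|κ| * Λ) * (1 + τ) := by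
  have h1 : ‖Bs o n M * siteMul T‖ ≤ 1 * (1 + τ) :=
    (Matrix.l2_opNorm_mul _ _).trans (mul_le_mul (opNorm_Bs_le o n M) (opNorm_siteMul_le_one_add n M hτ hT) (norm_nonneg _) zero_le_one)
  calc _ ≤ ‖Bs o n M * siteMul T‖ + ‖conjMat κ (coarseCW n M (o := o) ρ₀) (siteW n M ρ₀) (Bs o n M * siteMul T) - Bs o n M * siteMul T‖ :=
        opNorm_conjMat_le_add κ _ _ _
    _ ≤ 1 * (1 + τ) + (Real.exp (|κ| * Λ) - 1) * (1 + τ) := add_le_add h1 (opNorm_conjMat_Qu_sub_le n M κ hΛ hτ hosc hT)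
    _ = Real.exp (|κ| * Λ) * (1 + τ) := by ring

/-- and `‖c(Q′ᴴ)‖ ≤ e^{|κ|Λ}(1 + τ)` (`c_κ(Xᴴ) = (c_{−κ}X)ᴴ`). [folklore] -/
theorem opNorm_conjMat_QuH_le (κ : ℝ) {Λ τ : ℝ} (hΛ : 0 ≤ Λ) (hτ : 0 ≤ τ)
    (hosc : ∀ x x', blockOf n M x = blockOf n M x' → |ρ₀ x - ρ₀ x'| ≤ Λ) {T : Tor (fine n M) → Matrix o o ℂ} (hT : ∀ x, ‖T x - 1‖ ≤ τ) :
    ‖conjMat κ (siteW n M ρ₀) (coarseCW n M (o := o) ρ₀) (Bs o n M * siteMul T)ᴴ‖ ≤ Real.exp (|κ| * Λ) * (1 + τ) := by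
  rw [conjMat_conjTranspose, Matrix.l2_opNorm_conjTranspose]
  have h := opNorm_conjMat_Qu_le n M (ρ₀ := ρ₀) (-κ) hΛ hτ hosc hT
  rwa [abs_neg] at h

end Averaging

/-! ## §2 The outer factor `Z = Q′G′D_Rᴴ` and its adjoint under conjugation -/

section Outer

variable {ρ₀ : Tor (fine n M) → ℝ} {κ a' : ℝ}
variable {R : Fin d → (Tor (fine n M) → Matrix o o ℂ)} {T : Tor (fine n M) → Matrix o o ℂ} {α τ : ℝ}

omit [NeZero n] hM in
/-- `Jcov` is even in the rate. [folklore] -/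
theorem Jcov_neg (co d : ℕ) (a' α τ κ : ℝ) : Jcov co d a' α τ (-κ) = Jcov co d a' α τ κ := by
  simp only [Jcov, neg_sq, Real.cosh_neg]

omit [NeZero n] hM in
/-- `cR` is even in the rate. [folklore] -/
theorem cR_neg (d : ℕ) (α κ : ℝ) : cR d α (-κ) = cR d α κ := by simp only [cR, abs_neg]

/-- **`‖c(Z)‖ ≤ e^{|κ|}(1 + τ)·K₂`** (`Z = Q′·(G′D_Rᴴ)`, middle weight = the site weight). [folklore] -/
theorem opNorm_conjMat_Z_le (ha' : 0 < a') (hα : 0 ≤ α) (hτ : 0 ≤ τ)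
    (hR : ∀ μ x, ‖connS (fine n M) ((n : ℕ) : ℂ) R μ x‖ ≤ α) (hT : ∀ x, ‖T x - 1‖ ≤ τ)
    (hlip : ∀ x ν, |ρ₀ (x + unitVec (fine n M) ν) - ρ₀ x| ≤ 1 / n) (hosc : ∀ x x', blockOf n M x = blockOf n M x' → |ρ₀ x - ρ₀ x'| ≤ 1)
    (hγ : 0 < gammaU d a' α τ - Jcov (Fintype.card o) d a' α τ κ) :
    ‖conjMat κ (coarseCW n M (o := o) ρ₀) (bondCW n M (o := o) ρ₀)
        (Zop (fine n M) ((n : ℕ) : ℂ) R (scalarOp n M a' R T)⁻¹ (Bs o n M * siteMul T))‖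
      ≤ Real.exp |κ| * (1 + τ)
        * K2 (gammaU d a' α τ - Jcov (Fintype.card o) d a' α τ κ) (Jcov (Fintype.card o) d a' α τ κ) (cR d α κ) := by
  rw [Zop, Matrix.mul_assoc, conjMat_mul κ _ (siteW n M ρ₀) _]
  have h1 := opNorm_conjMat_Qu_le n M (ρ₀ := ρ₀) (o := o) κ zero_le_one hτ hosc hT
  rw [mul_one] at h1
  exact (Matrix.l2_opNorm_mul _ _).trans (mul_le_mul h1 (opNorm_conjMat_inv_covGradH_le n M ha' hα hτ hR hT hlip hosc hγ) (norm_nonneg _)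
    (by positivity))

/-- **`‖c(Zᴴ)‖ ≤ e^{|κ|}(1 + τ)·K₂`** — the same bound (`c_κ(Zᴴ) = (c_{−κ}Z)ᴴ`; `Jcov`, `cR` are even in `κ`). [folklore] -/
theorem opNorm_conjMat_ZH_le (ha' : 0 < a') (hα : 0 ≤ α) (hτ : 0 ≤ τ)
    (hR : ∀ μ x, ‖connS (fine n M) ((n : ℕ) : ℂ) R μ x‖ ≤ α) (hT : ∀ x, ‖T x - 1‖ ≤ τ)
    (hlip : ∀ x ν, |ρ₀ (x + unitVec (fine n M) ν) - ρ₀ x| ≤ 1 / n) (hosc : ∀ x x', blockOf n M x = blockOf n M x' → |ρ₀ x - ρ₀ x'| ≤ 1)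
    (hγ : 0 < gammaU d a' α τ - Jcov (Fintype.card o) d a' α τ κ) :
    ‖conjMat κ (bondCW n M (o := o) ρ₀) (coarseCW n M (o := o) ρ₀)
        (Zop (fine n M) ((n : ℕ) : ℂ) R (scalarOp n M a' R T)⁻¹ (Bs o n M * siteMul T))ᴴ‖
      ≤ Real.exp |κ| * (1 + τ)
        * K2 (gammaU d a' α τ - Jcov (Fintype.card o) d a' α τ κ) (Jcov (Fintype.card o) d a' α τ κ) (cR d α κ) := by
  rw [conjMat_conjTranspose, Matrix.l2_opNorm_conjTranspose]
  have hγ' : 0 < gammaU d a' α τ - Jcov (Fintype.card o) d a' α τ (-κ) := by rwa [Jcov_neg]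
  have h := opNorm_conjMat_Z_le n M (ρ₀ := ρ₀) ha' hα hτ hR hT hlip hosc hγ'
  rwa [abs_neg, Jcov_neg, cR_neg] at h

end Outer

/-! ## §3 The sandwich modulo the conjugated unit-layer factor -/

section Sandwich

variable {ρ₀ : Tor (fine n M) → ℝ} {κ a' : ℝ}
variable {R : Fin d → (Tor (fine n M) → Matrix o o ℂ)} {T : Tor (fine n M) → Matrix o o ℂ} {α τ ν : ℝ}

/-- `G′ = S_U⁻¹` is Hermitian. [folklore] -/
theorem scalarOp_inv_isHermitian (a' : ℝ) (R : Fin d → (Tor (fine n M) → Matrix o o ℂ)) (T : Tor (fine n M) → Matrix o o ℂ) :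
    ((scalarOp n M a' R T)⁻¹).IsHermitian := (scalarOp_isHermitian n M a' R T).inv

/-- **THE GAUGE SANDWICH OF ONE FAMILY UNDER CONJUGATION, MODULO THE UNIT-LAYER FACTOR**: with a displayed bound `ν` on
`‖conjMat κ σ σ N‖`, `N = (Q′G′G′Q′ᴴ)⁻¹`, `‖c(D_R·P·D_Rᴴ)‖ ≤ (e^{|κ|}(1+τ)K₂)·ν·(e^{|κ|}(1+τ)K₂)` (`D_R P D_Rᴴ = Zᴴ N Z`,
`GaugeTermSandwichBound.sand_projP_eq`). [folklore] -/
theorem opNorm_conjMat_gaugeSandwich_le (ha' : 0 < a') (hα : 0 ≤ α) (hτ : 0 ≤ τ)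
    (hR : ∀ μ x, ‖connS (fine n M) ((n : ℕ) : ℂ) R μ x‖ ≤ α) (hT : ∀ x, ‖T x - 1‖ ≤ τ)
    (hlip : ∀ x ν, |ρ₀ (x + unitVec (fine n M) ν) - ρ₀ x| ≤ 1 / n) (hosc : ∀ x x', blockOf n M x = blockOf n M x' → |ρ₀ x - ρ₀ x'| ≤ 1)
    (hγ : 0 < gammaU d a' α τ - Jcov (Fintype.card o) d a' α τ κ) (hν : 0 ≤ ν)
    (hN : ‖conjMat κ (coarseCW n M (o := o) ρ₀) (coarseCW n M (o := o) ρ₀)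
      (Nop (fine n M) (scalarOp n M a' R T)⁻¹ (Bs o n M * siteMul T))‖ ≤ ν) :
    ‖conjMat κ (bondCW n M (o := o) ρ₀) (bondCW n M (o := o) ρ₀)
        (sand (fine n M) ((n : ℕ) : ℂ) R (projP (fine n M) (scalarOp n M a' R T)⁻¹ (Bs o n M * siteMul T)))‖
      ≤ (Real.exp |κ| * (1 + τ) * K2 (gammaU d a' α τ - Jcov (Fintype.card o) d a' α τ κ) (Jcov (Fintype.card o) d a' α τ κ) (cR d α κ))
        * ν
        * (Real.exp |κ| * (1 + τ) * K2 (gammaU d a' α τ - Jcov (Fintype.card o) d a' α τ κ) (Jcov (Fintype.card o) d a' α τ κ) (cR d α κ)) := by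
  rw [sand_projP_eq (fine n M) ((n : ℕ) : ℂ) R (scalarOp_inv_isHermitian n M a' R T) (Bs o n M * siteMul T),
    conjMat_mul κ _ (coarseCW n M (o := o) ρ₀) _, conjMat_mul κ _ (coarseCW n M (o := o) ρ₀) _]
  have hZ := opNorm_conjMat_Z_le n M (ρ₀ := ρ₀) ha' hα hτ hR hT hlip hosc hγ
  have hZH := opNorm_conjMat_ZH_le n M (ρ₀ := ρ₀) ha' hα hτ hR hT hlip hosc hγ
  have h0 : 0 ≤ Real.exp |κ| * (1 + τ) * K2 (gammaU d a' α τ - Jcov (Fintype.card o) d a' α τ κ) (Jcov (Fintype.card o) d a' α τ κ)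
      (cR d α κ) := by have := K2_nonneg (gammaU d a' α τ - Jcov (Fintype.card o) d a' α τ κ) (Jcov (Fintype.card o) d a' α τ κ) (cR d α κ); positivity
  calc _ ≤ ‖conjMat κ (bondCW n M (o := o) ρ₀) (coarseCW n M (o := o) ρ₀)
            (Zop (fine n M) ((n : ℕ) : ℂ) R (scalarOp n M a' R T)⁻¹ (Bs o n M * siteMul T))ᴴ
          * conjMat κ (coarseCW n M (o := o) ρ₀) (coarseCW n M (o := o) ρ₀)
            (Nop (fine n M) (scalarOp n M a' R T)⁻¹ (Bs o n M * siteMul T))‖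
        * ‖conjMat κ (coarseCW n M (o := o) ρ₀) (bondCW n M (o := o) ρ₀)
            (Zop (fine n M) ((n : ℕ) : ℂ) R (scalarOp n M a' R T)⁻¹ (Bs o n M * siteMul T))‖ := Matrix.l2_opNorm_mul _ _
    _ ≤ (‖conjMat κ (bondCW n M (o := o) ρ₀) (coarseCW n M (o := o) ρ₀)
            (Zop (fine n M) ((n : ℕ) : ℂ) R (scalarOp n M a' R T)⁻¹ (Bs o n M * siteMul T))ᴴ‖
          * ‖conjMat κ (coarseCW n M (o := o) ρ₀) (coarseCW n M (o := o) ρ₀)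
            (Nop (fine n M) (scalarOp n M a' R T)⁻¹ (Bs o n M * siteMul T))‖)
        * ‖conjMat κ (coarseCW n M (o := o) ρ₀) (bondCW n M (o := o) ρ₀)
            (Zop (fine n M) ((n : ℕ) : ℂ) R (scalarOp n M a' R T)⁻¹ (Bs o n M * siteMul T))‖ :=
        mul_le_mul_of_nonneg_right (Matrix.l2_opNorm_mul _ _) (norm_nonneg _)
    _ ≤ _ := mul_le_mul (mul_le_mul hZH hN (norm_nonneg _) h0) hZ (norm_nonneg _) (mul_nonneg h0 hν)

end Sandwich


end Summit.QuantumFields.BalabanUV.T4Continuum.CTGaugeSandwichHbd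

end
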